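import Mathlib
import Summits.Ventures.PercRepro2.CoinK2StateLayer

/-!
# The head-aware two-entry block theorem (blind cell PercRepro2, night-2 g13;
proofs/NIGHT2-DARC.md §48)

Per ENTRY STATE `e ∈ {0, 1, 2, 3}`: `l_e, x_e, y_e, z_e` (mass, marker-1 mass, marker-2 mass, both) for
the `R`-law and `n_e, a_e, b_e, c_e` for the gate (`e ∈ {1, 2, 3}`; on the entry-free state the gate
IS the `R`-law).  Under the Ahlswede–Daykin relations listed as hypotheses — within-state
log-supermodularity of the gate (`hC`), the within-state tilt `p_e ≤ P_e` (`hT`), the gate means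
increasing along the state lattice (`hG`), the filter / ideal mean orderings of the `R`-law (`hF`,
`hTop`, `hId`), the state masses log-supermodular (`hlsm`), the gate masses dominated and
ratio-ordered (`hR`, `hr`) — the cleared functional `Λ²M₁₁ − ΛΛ₁M₂ − ΛΛ₂M₁ + Λ₁Λ₂M` is
nonnegative (`k2State_nonneg`).

Mechanism: the state-wise tilt identity `n_e F_e = Λ²(n_e c_e − a_e b_e) + D₁ᵉD₂ᵉ` (`state_tilt`)
writes the functional as `Λ²Σ_e [C_e/n_e + n_e u_e w_e]` with `u_e = P_e − p`, `w_e = Q_e − q` the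
marker-mean shifts of the state's gate law against the global `R`-law means; `C_e ≥ 0`, and
`stateLayer_nonneg` (the layer cake on the state lattice) closes, fed by `chainShift_nonneg` and
`latticeShift_nonneg`.  Pure algebra, Mathlib only. -/

namespace Summit.Ventures.PercRepro2.Coin

section StateCells

variable {R : Type*} [Field R] [LinearOrder R] [IsStrictOrderedRing R]

omit [LinearOrder R] [IsStrictOrderedRing R] in
/-- The state-wise tilt identity: a state of gate mass `n`, marker masses `a, b`, joint mass `c`
(all vanishing with `n`) contributes `Λ²(nc − ab)/n + Λ² n (a/n − Λ₁/Λ)(b/n − Λ₂/Λ)`. -/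
theorem state_tilt (Λ Λ₁ Λ₂ n a b c : R) (hΛ : Λ ≠ 0) (h0 : n = 0 → a = 0 ∧ b = 0 ∧ c = 0) :
    Λ ^ 2 * c - Λ * Λ₁ * b - Λ * Λ₂ * a + Λ₁ * Λ₂ * n =
      Λ ^ 2 * ((n * c - a * b) / n) + Λ ^ 2 * (n * ((a / n - Λ₁ / Λ) * (b / n - Λ₂ / Λ))) := by
  rcases eq_or_ne n 0 with hn | hn
  · obtain ⟨ha, hb, hc⟩ := h0 hn
    subst hn ha hb hc
    simp
  · field_simp
    ring

/-- `x ≤ l · (a / n)` from `x n ≤ l a` (`n > 0`). -/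
theorem le_mul_div_of_mul_le {l n a x : R} (hn : 0 < n) (h : x * n ≤ l * a) :
    x ≤ l * (a / n) := by
  rw [mul_div_assoc', le_div_iff₀ hn]
  exact h

/-- `c / d ≤ a / b` from `c b ≤ d a` (`b, d > 0`). -/
theorem div_le_div_of_mul_le' {a b c d : R} (hb : 0 < b) (hd : 0 < d) (h : c * b ≤ d * a) :
    c / d ≤ a / b := by
  rw [div_le_div_iff₀ hd hb, mul_comm a d]
  exact h

/-- **The chain `{1 < 3}` of the state lattice**: a singly-entered state of positive gate mass and
the doubly-entered state above it; the weighted sum of the shift products is nonnegative. -/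
theorem chainShift_nonneg (l₁ l₃ n₁ n₃ x₁ x₃ a₁ a₃ y₁ y₃ b₁ b₃ p q : R)
    (hl₃ : 0 ≤ l₃) (hn₃ : 0 ≤ n₃) (h1 : 0 < n₁) (hR₁ : n₁ ≤ l₁) (hr₁ : n₁ * l₃ ≤ l₁ * n₃)
    (hx₃ : x₃ ≤ l₃) (hy₃ : y₃ ≤ l₃)
    (hTa₁ : x₁ * n₁ ≤ l₁ * a₁) (hTa₃ : x₃ * n₃ ≤ l₃ * a₃)
    (hTb₁ : y₁ * n₁ ≤ l₁ * b₁) (hTb₃ : y₃ * n₃ ≤ l₃ * b₃)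
    (hGa : a₁ * n₃ ≤ n₁ * a₃) (hGb : b₁ * n₃ ≤ n₁ * b₃)
    (hp : (l₁ + l₃) * p ≤ x₁ + x₃) (hq : (l₁ + l₃) * q ≤ y₁ + y₃) :
    0 ≤ l₁ * ((a₁ / n₁ - p) * (b₁ / n₁ - q)) + l₃ * ((a₃ / n₃ - p) * (b₃ / n₃ - q)) := by
  have hl₁ : 0 ≤ l₁ := le_trans h1.le hR₁
  -- either `l₃ = 0` (and the top state is absent) or `n₃ > 0`
  have hdich : l₃ = 0 ∨ 0 < n₃ := by
    rcases hl₃.eq_or_lt with h3 | h3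
    · exact Or.inl h3.symm
    · rcases hn₃.eq_or_lt with h' | h'
      · exfalso; rw [← h'] at hr₁; have := mul_pos h1 h3; linarith
      · exact Or.inr h'
  apply chain2_nonneg l₁ l₃ (a₁ / n₁ - p) (a₃ / n₃ - p) (b₁ / n₁ - q) (b₃ / n₃ - q) hl₁ hl₃
  · rcases hdich with h3 | h3
    · rw [h3]; simp
    · have e1 : a₁ / n₁ ≤ a₃ / n₃ := div_le_div_of_mul_le' h3 h1 hGa
      have e2 : b₁ / n₁ ≤ b₃ / n₃ := div_le_div_of_mul_le' h3 h1 hGb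
      exact mul_nonneg (mul_nonneg hl₁ hl₃) (mul_nonneg (by linarith) (by linarith))
  · have e1 : x₁ ≤ l₁ * (a₁ / n₁) := le_mul_div_of_mul_le h1 hTa₁
    have e3 : x₃ ≤ l₃ * (a₃ / n₃) := by
      rcases hdich with h3 | h3
      · rw [h3, zero_mul]; linarith
      · exact le_mul_div_of_mul_le h3 hTa₃
    have : l₁ * (a₁ / n₁ - p) + l₃ * (a₃ / n₃ - p)
        = l₁ * (a₁ / n₁) + l₃ * (a₃ / n₃) - (l₁ + l₃) * p := by ring
    rw [this]; linarith
  · have e1 : y₁ ≤ l₁ * (b₁ / n₁) := le_mul_div_of_mul_le h1 hTb₁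
    have e3 : y₃ ≤ l₃ * (b₃ / n₃) := by
      rcases hdich with h3 | h3
      · rw [h3, zero_mul]; linarith
      · exact le_mul_div_of_mul_le h3 hTb₃
    have : l₁ * (b₁ / n₁ - q) + l₃ * (b₃ / n₃ - q)
        = l₁ * (b₁ / n₁) + l₃ * (b₃ / n₃) - (l₁ + l₃) * q := by ring
    rw [this]; linarith

/-- **FKG on the whole state lattice** for the shift products, when both singly-entered states
carry gate mass (then every state does). -/
theorem latticeShift_nonneg (l₀ l₁ l₂ l₃ n₁ n₂ n₃ x₀ x₁ x₂ x₃ a₁ a₂ a₃ y₀ y₁ y₂ y₃ b₁ b₂ b₃ p q : R)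
    (hl₀ : 0 ≤ l₀) (hl₃ : 0 ≤ l₃) (hn₃ : 0 ≤ n₃) (h1 : 0 < n₁) (h2 : 0 < n₂)
    (hR₁ : n₁ ≤ l₁) (hR₂ : n₂ ≤ l₂) (hr₁ : n₁ * l₃ ≤ l₁ * n₃) (hlsm : l₁ * l₂ ≤ l₀ * l₃)
    (hTa₁ : x₁ * n₁ ≤ l₁ * a₁) (hTa₂ : x₂ * n₂ ≤ l₂ * a₂) (hTa₃ : x₃ * n₃ ≤ l₃ * a₃)
    (hTb₁ : y₁ * n₁ ≤ l₁ * b₁) (hTb₂ : y₂ * n₂ ≤ l₂ * b₂) (hTb₃ : y₃ * n₃ ≤ l₃ * b₃)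
    (hGa₀₁ : x₀ * n₁ ≤ l₀ * a₁) (hGa₀₂ : x₀ * n₂ ≤ l₀ * a₂)
    (hGa₁₃ : a₁ * n₃ ≤ n₁ * a₃) (hGa₂₃ : a₂ * n₃ ≤ n₂ * a₃)
    (hGb₀₁ : y₀ * n₁ ≤ l₀ * b₁) (hGb₀₂ : y₀ * n₂ ≤ l₀ * b₂)
    (hGb₁₃ : b₁ * n₃ ≤ n₁ * b₃) (hGb₂₃ : b₂ * n₃ ≤ n₂ * b₃)
    (hp : (l₀ + l₁ + l₂ + l₃) * p = x₀ + x₁ + x₂ + x₃)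
    (hq : (l₀ + l₁ + l₂ + l₃) * q = y₀ + y₁ + y₂ + y₃) :
    0 ≤ l₀ * ((x₀ / l₀ - p) * (y₀ / l₀ - q)) + l₁ * ((a₁ / n₁ - p) * (b₁ / n₁ - q))
      + l₂ * ((a₂ / n₂ - p) * (b₂ / n₂ - q)) + l₃ * ((a₃ / n₃ - p) * (b₃ / n₃ - q)) := by
  have hl₁pos : 0 < l₁ := lt_of_lt_of_le h1 hR₁
  have hl₂pos : 0 < l₂ := lt_of_lt_of_le h2 hR₂
  have hl₀l₃ : 0 < l₀ * l₃ := lt_of_lt_of_le (mul_pos hl₁pos hl₂pos) hlsm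
  have hl₀pos : 0 < l₀ := by
    rcases hl₀.eq_or_lt with h | h
    · exfalso; rw [← h] at hl₀l₃; simp at hl₀l₃
    · exact h
  have hl₃pos : 0 < l₃ := by
    rcases hl₃.eq_or_lt with h | h
    · exfalso; rw [← h] at hl₀l₃; simp at hl₀l₃
    · exact h
  have hn₃pos : 0 < n₃ := by
    rcases hn₃.eq_or_lt with h' | h'
    · exfalso; rw [← h'] at hr₁; have := mul_pos h1 hl₃pos; linarith
    · exact h'
  -- the eight monotonicity facts of the gate means
  have m01 : x₀ / l₀ ≤ a₁ / n₁ := div_le_div_of_mul_le' h1 hl₀pos hGa₀₁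
  have m02 : x₀ / l₀ ≤ a₂ / n₂ := div_le_div_of_mul_le' h2 hl₀pos hGa₀₂
  have m13 : a₁ / n₁ ≤ a₃ / n₃ := div_le_div_of_mul_le' hn₃pos h1 hGa₁₃
  have m23 : a₂ / n₂ ≤ a₃ / n₃ := div_le_div_of_mul_le' hn₃pos h2 hGa₂₃
  have n01 : y₀ / l₀ ≤ b₁ / n₁ := div_le_div_of_mul_le' h1 hl₀pos hGb₀₁
  have n02 : y₀ / l₀ ≤ b₂ / n₂ := div_le_div_of_mul_le' h2 hl₀pos hGb₀₂
  have n13 : b₁ / n₁ ≤ b₃ / n₃ := div_le_div_of_mul_le' hn₃pos h1 hGb₁₃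
  have n23 : b₂ / n₂ ≤ b₃ / n₃ := div_le_div_of_mul_le' hn₃pos h2 hGb₂₃
  apply fkg22_nonneg l₀ l₁ l₂ l₃ (x₀ / l₀ - p) (a₁ / n₁ - p) (a₂ / n₂ - p) (a₃ / n₃ - p)
    (y₀ / l₀ - q) (b₁ / n₁ - q) (b₂ / n₂ - q) (b₃ / n₃ - q) hl₀ hl₁pos.le hl₂pos.le hl₃
  · exact mul_nonneg (mul_nonneg hl₀ hl₁pos.le) (mul_nonneg (by linarith) (by linarith))
  · exact mul_nonneg (mul_nonneg hl₀ hl₂pos.le) (mul_nonneg (by linarith) (by linarith))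
  · exact mul_nonneg (mul_nonneg hl₁pos.le hl₃) (mul_nonneg (by linarith) (by linarith))
  · exact mul_nonneg (mul_nonneg hl₂pos.le hl₃) (mul_nonneg (by linarith) (by linarith))
  · exact pair_cross_nonneg l₀ l₁ l₂ l₃ _ _ _ _ _ _ _ _ hl₀ hl₁pos.le hl₂pos.le hl₃ hlsm
      (by linarith) (by linarith) (by linarith) (by linarith)
      (by linarith) (by linarith) (by linarith) (by linarith)
  · have e0 : l₀ * (x₀ / l₀) = x₀ := by field_simp
    have e1 : x₁ ≤ l₁ * (a₁ / n₁) := le_mul_div_of_mul_le h1 hTa₁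
    have e2 : x₂ ≤ l₂ * (a₂ / n₂) := le_mul_div_of_mul_le h2 hTa₂
    have e3 : x₃ ≤ l₃ * (a₃ / n₃) := le_mul_div_of_mul_le hn₃pos hTa₃
    have : l₀ * (x₀ / l₀ - p) + l₁ * (a₁ / n₁ - p) + l₂ * (a₂ / n₂ - p) + l₃ * (a₃ / n₃ - p)
        = (l₀ * (x₀ / l₀) + l₁ * (a₁ / n₁) + l₂ * (a₂ / n₂) + l₃ * (a₃ / n₃))
          - (l₀ + l₁ + l₂ + l₃) * p := by ring
    rw [this, hp, e0]; linarith
  · have e0 : l₀ * (y₀ / l₀) = y₀ := by field_simp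
    have e1 : y₁ ≤ l₁ * (b₁ / n₁) := le_mul_div_of_mul_le h1 hTb₁
    have e2 : y₂ ≤ l₂ * (b₂ / n₂) := le_mul_div_of_mul_le h2 hTb₂
    have e3 : y₃ ≤ l₃ * (b₃ / n₃) := le_mul_div_of_mul_le hn₃pos hTb₃
    have : l₀ * (y₀ / l₀ - q) + l₁ * (b₁ / n₁ - q) + l₂ * (b₂ / n₂ - q) + l₃ * (b₃ / n₃ - q)
        = (l₀ * (y₀ / l₀) + l₁ * (b₁ / n₁) + l₂ * (b₂ / n₂) + l₃ * (b₃ / n₃))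
          - (l₀ + l₁ + l₂ + l₃) * q := by ring
    rw [this, hq, e0]; linarith

/-- The ideal state: both mean shifts are `≤ 0`, so their product is `≥ 0`. -/
theorem idealShift_nonneg (l₀ x₀ y₀ Λ Λ₁ Λ₂ : R) (hl₀ : 0 ≤ l₀) (hΛ : 0 < Λ)
    (hΛ₁ : 0 ≤ Λ₁) (hΛ₂ : 0 ≤ Λ₂) (hIda : x₀ * Λ ≤ l₀ * Λ₁) (hIdb : y₀ * Λ ≤ l₀ * Λ₂) :
    0 ≤ (x₀ / l₀ - Λ₁ / Λ) * (y₀ / l₀ - Λ₂ / Λ) := by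
  have hp0 : 0 ≤ Λ₁ / Λ := div_nonneg hΛ₁ hΛ.le
  have hq0 : 0 ≤ Λ₂ / Λ := div_nonneg hΛ₂ hΛ.le
  apply mul_nonneg_of_nonpos_of_nonpos
  · rcases hl₀.eq_or_lt with h | h
    · rw [← h]; simp [hp0]
    · have := div_le_div_of_mul_le' hΛ h hIda; linarith
  · rcases hl₀.eq_or_lt with h | h
    · rw [← h]; simp [hq0]
    · have := div_le_div_of_mul_le' hΛ h hIdb; linarith

/-- The top state: both mean shifts are `≥ 0` when it carries gate mass (and `−p, −q` when it does
not), so their product is `≥ 0`. -/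
theorem topShift_nonneg (l₃ n₃ x₃ a₃ y₃ b₃ Λ Λ₁ Λ₂ : R) (hn₃ : 0 ≤ n₃) (hR₃ : n₃ ≤ l₃) (hΛ : 0 < Λ)
    (hΛ₁ : 0 ≤ Λ₁) (hΛ₂ : 0 ≤ Λ₂) (hTa₃ : x₃ * n₃ ≤ l₃ * a₃) (hTb₃ : y₃ * n₃ ≤ l₃ * b₃)
    (hTopa : l₃ * Λ₁ ≤ x₃ * Λ) (hTopb : l₃ * Λ₂ ≤ y₃ * Λ) :
    0 ≤ (a₃ / n₃ - Λ₁ / Λ) * (b₃ / n₃ - Λ₂ / Λ) := by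
  have hp0 : 0 ≤ Λ₁ / Λ := div_nonneg hΛ₁ hΛ.le
  have hq0 : 0 ≤ Λ₂ / Λ := div_nonneg hΛ₂ hΛ.le
  rcases hn₃.eq_or_lt with h | h
  · rw [← h]; simp
    exact mul_nonneg hp0 hq0
  · have hl₃pos : 0 < l₃ := lt_of_lt_of_le h hR₃
    have e1 : x₃ / l₃ ≤ a₃ / n₃ := div_le_div_of_mul_le' h hl₃pos hTa₃
    have e2 : Λ₁ / Λ ≤ x₃ / l₃ :=
      div_le_div_of_mul_le' hl₃pos hΛ (by rw [mul_comm Λ₁ l₃, mul_comm Λ x₃]; exact hTopa)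
    have e3 : y₃ / l₃ ≤ b₃ / n₃ := div_le_div_of_mul_le' h hl₃pos hTb₃
    have e4 : Λ₂ / Λ ≤ y₃ / l₃ :=
      div_le_div_of_mul_le' hl₃pos hΛ (by rw [mul_comm Λ₂ l₃, mul_comm Λ y₃]; exact hTopb)
    exact mul_nonneg (by linarith) (by linarith)

/-- **THE HEAD-AWARE TWO-ENTRY BLOCK THEOREM** (state-level cells), positive total mass. -/
theorem k2State_nonneg_of_pos
    (l₀ l₁ l₂ l₃ x₀ x₁ x₂ x₃ y₀ y₁ y₂ y₃ z₀ n₁ n₂ n₃ a₁ a₂ a₃ b₁ b₂ b₃ c₁ c₂ c₃ Λ Λ₁ Λ₂ : R)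
    (hΛ : Λ = l₀ + l₁ + l₂ + l₃) (hΛ₁ : Λ₁ = x₀ + x₁ + x₂ + x₃) (hΛ₂ : Λ₂ = y₀ + y₁ + y₂ + y₃)
    (hΛpos : 0 < Λ) (hΛ₁0 : 0 ≤ Λ₁) (hΛ₂0 : 0 ≤ Λ₂)
    -- nonnegativity and the block structure
    (hl₀ : 0 ≤ l₀) (hl₁ : 0 ≤ l₁) (hl₂ : 0 ≤ l₂) (hl₃ : 0 ≤ l₃)
    (hx₀ : 0 ≤ x₀) (hy₀ : 0 ≤ y₀) (hz₀ : 0 ≤ z₀)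
    (hxl₃ : x₃ ≤ l₃) (hyl₃ : y₃ ≤ l₃) (hxl₀ : x₀ ≤ l₀) (hyl₀ : y₀ ≤ l₀) (hzl₀ : z₀ ≤ l₀)
    (hn₁ : 0 ≤ n₁) (hn₂ : 0 ≤ n₂) (hn₃ : 0 ≤ n₃)
    (han₁ : a₁ ≤ n₁) (han₂ : a₂ ≤ n₂) (han₃ : a₃ ≤ n₃) (hbn₁ : b₁ ≤ n₁) (hbn₂ : b₂ ≤ n₂)
    (hbn₃ : b₃ ≤ n₃) (hcn₁ : c₁ ≤ n₁) (hcn₂ : c₂ ≤ n₂) (hcn₃ : c₃ ≤ n₃)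
    (ha₁ : 0 ≤ a₁) (ha₂ : 0 ≤ a₂) (ha₃ : 0 ≤ a₃) (hb₁ : 0 ≤ b₁) (hb₂ : 0 ≤ b₂) (hb₃ : 0 ≤ b₃)
    (hc₁ : 0 ≤ c₁) (hc₂ : 0 ≤ c₂) (hc₃ : 0 ≤ c₃)
    -- within-state log-supermodularity (FKG at block level)
    (hC₀ : x₀ * y₀ ≤ l₀ * z₀) (hC₁ : a₁ * b₁ ≤ n₁ * c₁) (hC₂ : a₂ * b₂ ≤ n₂ * c₂)
    (hC₃ : a₃ * b₃ ≤ n₃ * c₃)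
    -- the within-state tilt: the gate raises both marker means
    (hTa₁ : x₁ * n₁ ≤ l₁ * a₁) (hTa₂ : x₂ * n₂ ≤ l₂ * a₂) (hTa₃ : x₃ * n₃ ≤ l₃ * a₃)
    (hTb₁ : y₁ * n₁ ≤ l₁ * b₁) (hTb₂ : y₂ * n₂ ≤ l₂ * b₂) (hTb₃ : y₃ * n₃ ≤ l₃ * b₃)
    -- the gate means increase along the state lattice `0 < 1, 2 < 3`
    (hGa₀₁ : x₀ * n₁ ≤ l₀ * a₁) (hGa₀₂ : x₀ * n₂ ≤ l₀ * a₂)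
    (hGa₁₃ : a₁ * n₃ ≤ n₁ * a₃) (hGa₂₃ : a₂ * n₃ ≤ n₂ * a₃)
    (hGb₀₁ : y₀ * n₁ ≤ l₀ * b₁) (hGb₀₂ : y₀ * n₂ ≤ l₀ * b₂)
    (hGb₁₃ : b₁ * n₃ ≤ n₁ * b₃) (hGb₂₃ : b₂ * n₃ ≤ n₂ * b₃)
    -- filter, top and ideal mean orderings of the `R`-law
    (hFa₁ : (l₁ + l₃) * Λ₁ ≤ (x₁ + x₃) * Λ) (hFa₂ : (l₂ + l₃) * Λ₁ ≤ (x₂ + x₃) * Λ)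
    (hFb₁ : (l₁ + l₃) * Λ₂ ≤ (y₁ + y₃) * Λ) (hFb₂ : (l₂ + l₃) * Λ₂ ≤ (y₂ + y₃) * Λ)
    (hTopa : l₃ * Λ₁ ≤ x₃ * Λ) (hTopb : l₃ * Λ₂ ≤ y₃ * Λ)
    (hIda : x₀ * Λ ≤ l₀ * Λ₁) (hIdb : y₀ * Λ ≤ l₀ * Λ₂)
    -- the state masses are log-supermodular; the gate masses are dominated and ratio-ordered
    (hlsm : l₁ * l₂ ≤ l₀ * l₃)
    (hR₁ : n₁ ≤ l₁) (hR₂ : n₂ ≤ l₂) (hR₃ : n₃ ≤ l₃)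
    (hr₁ : n₁ * l₃ ≤ l₁ * n₃) (hr₂ : n₂ * l₃ ≤ l₂ * n₃) :
    0 ≤ Λ ^ 2 * (z₀ + c₁ + c₂ + c₃) - Λ * Λ₁ * (y₀ + b₁ + b₂ + b₃)
        - Λ * Λ₂ * (x₀ + a₁ + a₂ + a₃) + Λ₁ * Λ₂ * (l₀ + n₁ + n₂ + n₃) := by
  have hΛne : Λ ≠ 0 := hΛpos.ne'
  -- the means
  obtain ⟨p, hp⟩ : ∃ p : R, p = Λ₁ / Λ := ⟨_, rfl⟩
  obtain ⟨q, hq⟩ : ∃ q : R, q = Λ₂ / Λ := ⟨_, rfl⟩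
  have hΛp : Λ * p = Λ₁ := by rw [hp]; field_simp
  have hΛq : Λ * q = Λ₂ := by rw [hq]; field_simp
  -- the four state-wise tilt identities
  have t₀ := state_tilt Λ Λ₁ Λ₂ l₀ x₀ y₀ z₀ hΛne (fun h =>
    ⟨le_antisymm (h ▸ hxl₀) hx₀, le_antisymm (h ▸ hyl₀) hy₀, le_antisymm (h ▸ hzl₀) hz₀⟩)
  have t₁ := state_tilt Λ Λ₁ Λ₂ n₁ a₁ b₁ c₁ hΛne (fun h =>
    ⟨le_antisymm (h ▸ han₁) ha₁, le_antisymm (h ▸ hbn₁) hb₁, le_antisymm (h ▸ hcn₁) hc₁⟩)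
  have t₂ := state_tilt Λ Λ₁ Λ₂ n₂ a₂ b₂ c₂ hΛne (fun h =>
    ⟨le_antisymm (h ▸ han₂) ha₂, le_antisymm (h ▸ hbn₂) hb₂, le_antisymm (h ▸ hcn₂) hc₂⟩)
  have t₃ := state_tilt Λ Λ₁ Λ₂ n₃ a₃ b₃ c₃ hΛne (fun h =>
    ⟨le_antisymm (h ▸ han₃) ha₃, le_antisymm (h ▸ hbn₃) hb₃, le_antisymm (h ▸ hcn₃) hc₃⟩)
  rw [← hp, ← hq] at t₀ t₁ t₂ t₃
  -- the within-state covariances are nonnegative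
  have hcov₀ : 0 ≤ (l₀ * z₀ - x₀ * y₀) / l₀ := div_nonneg (sub_nonneg.2 hC₀) hl₀
  have hcov₁ : 0 ≤ (n₁ * c₁ - a₁ * b₁) / n₁ := div_nonneg (sub_nonneg.2 hC₁) hn₁
  have hcov₂ : 0 ≤ (n₂ * c₂ - a₂ * b₂) / n₂ := div_nonneg (sub_nonneg.2 hC₂) hn₂
  have hcov₃ : 0 ≤ (n₃ * c₃ - a₃ * b₃) / n₃ := div_nonneg (sub_nonneg.2 hC₃) hn₃
  -- the layer cake on the state lattice
  have hO := idealShift_nonneg l₀ x₀ y₀ Λ Λ₁ Λ₂ hl₀ hΛpos hΛ₁0 hΛ₂0 hIda hIdb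
  have hZ := topShift_nonneg l₃ n₃ x₃ a₃ y₃ b₃ Λ Λ₁ Λ₂ hn₃ hR₃ hΛpos hΛ₁0 hΛ₂0 hTa₃ hTb₃ hTopa hTopb
  rw [← hp, ← hq] at hO hZ
  have hS1 : 0 < n₁ → 0 ≤ l₁ * ((a₁ / n₁ - p) * (b₁ / n₁ - q))
      + l₃ * ((a₃ / n₃ - p) * (b₃ / n₃ - q)) := fun h1 =>
    chainShift_nonneg l₁ l₃ n₁ n₃ x₁ x₃ a₁ a₃ y₁ y₃ b₁ b₃ p q hl₃ hn₃ h1 hR₁ hr₁ hxl₃ hyl₃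
      hTa₁ hTa₃ hTb₁ hTb₃ hGa₁₃ hGb₁₃
      (by rw [hp, mul_div_assoc', div_le_iff₀ hΛpos]; exact hFa₁)
      (by rw [hq, mul_div_assoc', div_le_iff₀ hΛpos]; exact hFb₁)
  have hS2 : 0 < n₂ → 0 ≤ l₂ * ((a₂ / n₂ - p) * (b₂ / n₂ - q))
      + l₃ * ((a₃ / n₃ - p) * (b₃ / n₃ - q)) := fun h2 =>
    chainShift_nonneg l₂ l₃ n₂ n₃ x₂ x₃ a₂ a₃ y₂ y₃ b₂ b₃ p q hl₃ hn₃ h2 hR₂ hr₂ hxl₃ hyl₃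
      hTa₂ hTa₃ hTb₂ hTb₃ hGa₂₃ hGb₂₃
      (by rw [hp, mul_div_assoc', div_le_iff₀ hΛpos]; exact hFa₂)
      (by rw [hq, mul_div_assoc', div_le_iff₀ hΛpos]; exact hFb₂)
  have hSE : 0 < n₁ → 0 < n₂ →
      0 ≤ l₀ * ((x₀ / l₀ - p) * (y₀ / l₀ - q)) + l₁ * ((a₁ / n₁ - p) * (b₁ / n₁ - q))
        + l₂ * ((a₂ / n₂ - p) * (b₂ / n₂ - q)) + l₃ * ((a₃ / n₃ - p) * (b₃ / n₃ - q)) :=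
    fun h1 h2 =>
    latticeShift_nonneg l₀ l₁ l₂ l₃ n₁ n₂ n₃ x₀ x₁ x₂ x₃ a₁ a₂ a₃ y₀ y₁ y₂ y₃ b₁ b₂ b₃ p q hl₀ hl₃
      hn₃ h1 h2 hR₁ hR₂ hr₁ hlsm hTa₁ hTa₂ hTa₃ hTb₁ hTb₂ hTb₃ hGa₀₁ hGa₀₂ hGa₁₃ hGa₂₃ hGb₀₁ hGb₀₂
      hGb₁₃ hGb₂₃ (by rw [← hΛ, hΛp, hΛ₁]) (by rw [← hΛ, hΛq, hΛ₂])
  have hLC := stateLayer_nonneg l₀ l₁ l₂ l₃ n₁ n₂ n₃ _ _ _ _ hl₀ hl₁ hl₂ hl₃ hn₁ hn₂ hn₃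
    hR₁ hR₂ hR₃ hr₁ hr₂ hO hZ hS1 hS2 hSE
  -- assemble
  have hsplit : Λ ^ 2 * (z₀ + c₁ + c₂ + c₃) - Λ * Λ₁ * (y₀ + b₁ + b₂ + b₃)
      - Λ * Λ₂ * (x₀ + a₁ + a₂ + a₃) + Λ₁ * Λ₂ * (l₀ + n₁ + n₂ + n₃)
      = (Λ ^ 2 * z₀ - Λ * Λ₁ * y₀ - Λ * Λ₂ * x₀ + Λ₁ * Λ₂ * l₀)
        + (Λ ^ 2 * c₁ - Λ * Λ₁ * b₁ - Λ * Λ₂ * a₁ + Λ₁ * Λ₂ * n₁)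
        + (Λ ^ 2 * c₂ - Λ * Λ₁ * b₂ - Λ * Λ₂ * a₂ + Λ₁ * Λ₂ * n₂)
        + (Λ ^ 2 * c₃ - Λ * Λ₁ * b₃ - Λ * Λ₂ * a₃ + Λ₁ * Λ₂ * n₃) := by ring
  rw [hsplit, t₀, t₁, t₂, t₃]
  have hsq : 0 ≤ Λ ^ 2 := sq_nonneg _
  have c0 := mul_nonneg hsq hcov₀
  have c1 := mul_nonneg hsq hcov₁
  have c2 := mul_nonneg hsq hcov₂
  have c3 := mul_nonneg hsq hcov₃
  have hlc := mul_nonneg hsq hLC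
  have e : Λ ^ 2 * (l₀ * ((x₀ / l₀ - p) * (y₀ / l₀ - q)) + n₁ * ((a₁ / n₁ - p) * (b₁ / n₁ - q))
        + n₂ * ((a₂ / n₂ - p) * (b₂ / n₂ - q)) + n₃ * ((a₃ / n₃ - p) * (b₃ / n₃ - q)))
      = Λ ^ 2 * (l₀ * ((x₀ / l₀ - p) * (y₀ / l₀ - q)))
        + Λ ^ 2 * (n₁ * ((a₁ / n₁ - p) * (b₁ / n₁ - q)))
        + Λ ^ 2 * (n₂ * ((a₂ / n₂ - p) * (b₂ / n₂ - q)))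
        + Λ ^ 2 * (n₃ * ((a₃ / n₃ - p) * (b₃ / n₃ - q))) := by ring
  rw [e] at hlc
  linarith only [c0, c1, c2, c3, hlc]

/-- **THE HEAD-AWARE TWO-ENTRY BLOCK THEOREM** (state-level cells). -/
theorem k2State_nonneg
    (l₀ l₁ l₂ l₃ x₀ x₁ x₂ x₃ y₀ y₁ y₂ y₃ z₀ z₁ z₂ z₃ n₁ n₂ n₃ a₁ a₂ a₃ b₁ b₂ b₃ c₁ c₂ c₃ : R)
    -- the `R`-law cells are nonnegative
    (hz₀ : 0 ≤ z₀) (hz₁ : 0 ≤ z₁) (hz₂ : 0 ≤ z₂) (hz₃ : 0 ≤ z₃)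
    (hzx₀ : z₀ ≤ x₀) (hzx₁ : z₁ ≤ x₁) (hzx₂ : z₂ ≤ x₂) (hzx₃ : z₃ ≤ x₃)
    (hzy₀ : z₀ ≤ y₀) (hzy₁ : z₁ ≤ y₁) (hzy₂ : z₂ ≤ y₂) (hzy₃ : z₃ ≤ y₃)
    (hl₀ : x₀ + y₀ - z₀ ≤ l₀) (hl₁ : x₁ + y₁ - z₁ ≤ l₁) (hl₂ : x₂ + y₂ - z₂ ≤ l₂)
    (hl₃ : x₃ + y₃ - z₃ ≤ l₃)
    -- the gate cells are nonnegative
    (hc₁ : 0 ≤ c₁) (hc₂ : 0 ≤ c₂) (hc₃ : 0 ≤ c₃)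
    (hca₁ : c₁ ≤ a₁) (hca₂ : c₂ ≤ a₂) (hca₃ : c₃ ≤ a₃)
    (hcb₁ : c₁ ≤ b₁) (hcb₂ : c₂ ≤ b₂) (hcb₃ : c₃ ≤ b₃)
    (hn₁ : a₁ + b₁ - c₁ ≤ n₁) (hn₂ : a₂ + b₂ - c₂ ≤ n₂) (hn₃ : a₃ + b₃ - c₃ ≤ n₃)
    -- within-state log-supermodularity (FKG at block level)
    (hC₀ : x₀ * y₀ ≤ l₀ * z₀) (hC₁ : a₁ * b₁ ≤ n₁ * c₁) (hC₂ : a₂ * b₂ ≤ n₂ * c₂)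
    (hC₃ : a₃ * b₃ ≤ n₃ * c₃)
    -- the within-state tilt: the gate raises both marker means
    (hTa₁ : x₁ * n₁ ≤ l₁ * a₁) (hTa₂ : x₂ * n₂ ≤ l₂ * a₂) (hTa₃ : x₃ * n₃ ≤ l₃ * a₃)
    (hTb₁ : y₁ * n₁ ≤ l₁ * b₁) (hTb₂ : y₂ * n₂ ≤ l₂ * b₂) (hTb₃ : y₃ * n₃ ≤ l₃ * b₃)
    -- the gate means increase along the state lattice `0 < 1, 2 < 3`
    (hGa₀₁ : x₀ * n₁ ≤ l₀ * a₁) (hGa₀₂ : x₀ * n₂ ≤ l₀ * a₂)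
    (hGa₁₃ : a₁ * n₃ ≤ n₁ * a₃) (hGa₂₃ : a₂ * n₃ ≤ n₂ * a₃)
    (hGb₀₁ : y₀ * n₁ ≤ l₀ * b₁) (hGb₀₂ : y₀ * n₂ ≤ l₀ * b₂)
    (hGb₁₃ : b₁ * n₃ ≤ n₁ * b₃) (hGb₂₃ : b₂ * n₃ ≤ n₂ * b₃)
    -- filter, top and ideal mean orderings of the `R`-law
    (hFa₁ : (l₁ + l₃) * (x₀ + x₁ + x₂ + x₃) ≤ (x₁ + x₃) * (l₀ + l₁ + l₂ + l₃))
    (hFa₂ : (l₂ + l₃) * (x₀ + x₁ + x₂ + x₃) ≤ (x₂ + x₃) * (l₀ + l₁ + l₂ + l₃))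
    (hFb₁ : (l₁ + l₃) * (y₀ + y₁ + y₂ + y₃) ≤ (y₁ + y₃) * (l₀ + l₁ + l₂ + l₃))
    (hFb₂ : (l₂ + l₃) * (y₀ + y₁ + y₂ + y₃) ≤ (y₂ + y₃) * (l₀ + l₁ + l₂ + l₃))
    (hTopa : l₃ * (x₀ + x₁ + x₂ + x₃) ≤ x₃ * (l₀ + l₁ + l₂ + l₃))
    (hTopb : l₃ * (y₀ + y₁ + y₂ + y₃) ≤ y₃ * (l₀ + l₁ + l₂ + l₃))
    (hIda : x₀ * (l₀ + l₁ + l₂ + l₃) ≤ l₀ * (x₀ + x₁ + x₂ + x₃))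
    (hIdb : y₀ * (l₀ + l₁ + l₂ + l₃) ≤ l₀ * (y₀ + y₁ + y₂ + y₃))
    -- the state masses are log-supermodular; the gate masses are dominated and ratio-ordered
    (hlsm : l₁ * l₂ ≤ l₀ * l₃)
    (hR₁ : n₁ ≤ l₁) (hR₂ : n₂ ≤ l₂) (hR₃ : n₃ ≤ l₃)
    (hr₁ : n₁ * l₃ ≤ l₁ * n₃) (hr₂ : n₂ * l₃ ≤ l₂ * n₃) :
    0 ≤ (l₀ + l₁ + l₂ + l₃) ^ 2 * (z₀ + c₁ + c₂ + c₃)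
        - (l₀ + l₁ + l₂ + l₃) * (x₀ + x₁ + x₂ + x₃) * (y₀ + b₁ + b₂ + b₃)
        - (l₀ + l₁ + l₂ + l₃) * (y₀ + y₁ + y₂ + y₃) * (x₀ + a₁ + a₂ + a₃)
        + (x₀ + x₁ + x₂ + x₃) * (y₀ + y₁ + y₂ + y₃) * (l₀ + n₁ + n₂ + n₃) := by
  have hx₀ : 0 ≤ x₀ := le_trans hz₀ hzx₀
  have hx₁ : 0 ≤ x₁ := le_trans hz₁ hzx₁
  have hx₂ : 0 ≤ x₂ := le_trans hz₂ hzx₂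
  have hx₃ : 0 ≤ x₃ := le_trans hz₃ hzx₃
  have hy₀ : 0 ≤ y₀ := le_trans hz₀ hzy₀
  have hy₁ : 0 ≤ y₁ := le_trans hz₁ hzy₁
  have hy₂ : 0 ≤ y₂ := le_trans hz₂ hzy₂
  have hy₃ : 0 ≤ y₃ := le_trans hz₃ hzy₃
  have hl₀' : 0 ≤ l₀ := by linarith only [hl₀, hzx₀, hy₀]
  have hl₁' : 0 ≤ l₁ := by linarith only [hl₁, hzx₁, hy₁]
  have hl₂' : 0 ≤ l₂ := by linarith only [hl₂, hzx₂, hy₂]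
  have hl₃' : 0 ≤ l₃ := by linarith only [hl₃, hzx₃, hy₃]
  have hxl₀ : x₀ ≤ l₀ := by linarith only [hl₀, hzy₀]
  have hyl₀ : y₀ ≤ l₀ := by linarith only [hl₀, hzx₀]
  have hzl₀ : z₀ ≤ l₀ := by linarith only [hl₀, hzx₀, hzy₀]
  have hxl₃ : x₃ ≤ l₃ := by linarith only [hl₃, hzy₃]
  have hyl₃ : y₃ ≤ l₃ := by linarith only [hl₃, hzx₃]
  have ha₁ : 0 ≤ a₁ := le_trans hc₁ hca₁
  have ha₂ : 0 ≤ a₂ := le_trans hc₂ hca₂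
  have ha₃ : 0 ≤ a₃ := le_trans hc₃ hca₃
  have hb₁ : 0 ≤ b₁ := le_trans hc₁ hcb₁
  have hb₂ : 0 ≤ b₂ := le_trans hc₂ hcb₂
  have hb₃ : 0 ≤ b₃ := le_trans hc₃ hcb₃
  have hΛ0 : 0 ≤ l₀ + l₁ + l₂ + l₃ := by linarith only [hl₀', hl₁', hl₂', hl₃']
  rcases hΛ0.eq_or_lt with hΛz | hΛpos
  · -- everything vanishes
    have e0 : l₀ = 0 := by linarith only [hΛz, hl₀', hl₁', hl₂', hl₃']
    have e1 : l₁ = 0 := by linarith only [hΛz, hl₀', hl₁', hl₂', hl₃']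
    have e2 : l₂ = 0 := by linarith only [hΛz, hl₀', hl₁', hl₂', hl₃']
    have e3 : l₃ = 0 := by linarith only [hΛz, hl₀', hl₁', hl₂', hl₃']
    have ex₀ : x₀ = 0 := le_antisymm (e0 ▸ hxl₀) hx₀
    have ex₁ : x₁ = 0 := by linarith only [e1, hl₁, hzy₁, hx₁]
    have ex₂ : x₂ = 0 := by linarith only [e2, hl₂, hzy₂, hx₂]
    have ex₃ : x₃ = 0 := le_antisymm (e3 ▸ hxl₃) hx₃
    have ey₀ : y₀ = 0 := le_antisymm (e0 ▸ hyl₀) hy₀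
    have ey₁ : y₁ = 0 := by linarith only [e1, hl₁, hzx₁, hy₁]
    have ey₂ : y₂ = 0 := by linarith only [e2, hl₂, hzx₂, hy₂]
    have ey₃ : y₃ = 0 := le_antisymm (e3 ▸ hyl₃) hy₃
    have en₁ : n₁ = 0 := le_antisymm (e1 ▸ hR₁) (by linarith only [hn₁, hca₁, hb₁])
    have en₂ : n₂ = 0 := le_antisymm (e2 ▸ hR₂) (by linarith only [hn₂, hca₂, hb₂])
    have en₃ : n₃ = 0 := le_antisymm (e3 ▸ hR₃) (by linarith only [hn₃, hca₃, hb₃])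
    rw [e0, e1, e2, e3, ex₀, ex₁, ex₂, ex₃, ey₀, ey₁, ey₂, ey₃, en₁, en₂, en₃]
    ring_nf
    exact le_refl 0
  · exact k2State_nonneg_of_pos l₀ l₁ l₂ l₃ x₀ x₁ x₂ x₃ y₀ y₁ y₂ y₃ z₀ n₁ n₂ n₃ a₁ a₂ a₃
      b₁ b₂ b₃ c₁ c₂ c₃ _ _ _ rfl rfl rfl hΛpos (by linarith only [hx₀, hx₁, hx₂, hx₃])
      (by linarith only [hy₀, hy₁, hy₂, hy₃]) hl₀' hl₁' hl₂' hl₃' hx₀ hy₀ hz₀ hxl₃ hyl₃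
      hxl₀ hyl₀ hzl₀ (by linarith only [hn₁, hca₁, hb₁]) (by linarith only [hn₂, hca₂, hb₂])
      (by linarith only [hn₃, hca₃, hb₃]) (by linarith only [hn₁, hcb₁])
      (by linarith only [hn₂, hcb₂]) (by linarith only [hn₃, hcb₃]) (by linarith only [hn₁, hca₁])
      (by linarith only [hn₂, hca₂]) (by linarith only [hn₃, hca₃])
      (by linarith only [hn₁, hca₁, hcb₁, hc₁]) (by linarith only [hn₂, hca₂, hcb₂, hc₂])
      (by linarith only [hn₃, hca₃, hcb₃, hc₃]) ha₁ ha₂ ha₃ hb₁ hb₂ hb₃ hc₁ hc₂ hc₃ hC₀ hC₁ hC₂ hC₃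
      hTa₁ hTa₂ hTa₃ hTb₁ hTb₂ hTb₃ hGa₀₁ hGa₀₂ hGa₁₃ hGa₂₃ hGb₀₁ hGb₀₂ hGb₁₃ hGb₂₃ hFa₁ hFa₂ hFb₁
      hFb₂ hTopa hTopb hIda hIdb hlsm hR₁ hR₂ hR₃ hr₁ hr₂

end StateCells

end Summit.Ventures.PercRepro2.Coin
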